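import Summits.Langlands.Langlands.Theses.PolyhedralTypeLadder

/-!
# Route PolyhedralTypeLadder — Assembly

The assembly item (stmt-Langlands-27322) of the child route `PolyhedralTypeLadder` (decomp-langlands lens-1 gen 21; a gate-native D-0170
refining child: `--refines route-Langlands-SeedParityLadder:MaassTypeSeedAvatars`, edge split, depth 1, no FRAME item; the hop below the
declared residual MIX was licensed by the census instrument verdict I-L1g19.B, row 239 i4) for the crux
MIX = `SeedParityLadder.MaassTypeSeedAvatars` (stmt-Langlands-27036):
`SolvableArtinTypeAvatars → NonSolvableTypeSeedAvatars → SeedParityLadder.MaassTypeSeedAvatars`.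

This is literally the type of the route file's sorry-free deciding theorem `Summit.Langlands.Langlands.Theses.PolyhedralTypeLadder.closes`
(one excluded middle on the member-level dial «solvable Artin type up to twist»).  Nothing here proves `Langlands` (nor MIX): the assembly
records only that the two ledger items of the route, taken together, imply the refined crux.
-/

set_option linter.dupNamespace false -- project-wide option (lakefile weak.linter.dupNamespace); `Summit.Langlands.Langlands` is the mandated namespace

namespace Summit.Langlands.Langlands.Theorems

/-- **Assembly of route PolyhedralTypeLadder** (stmt-Langlands-27322): `SOLV → INSOL → SeedParityLadder.MaassTypeSeedAvatars`.
Proof: unfold `Assembly` and apply the route's deciding theorem `Theses.PolyhedralTypeLadder.closes`. -/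
theorem polyhedralTypeLadder_assembly_proof :
    Summit.Langlands.Langlands.Theses.PolyhedralTypeLadder.Assembly := by
  unfold Summit.Langlands.Langlands.Theses.PolyhedralTypeLadder.Assembly
  exact Summit.Langlands.Langlands.Theses.PolyhedralTypeLadder.closes

end Summit.Langlands.Langlands.Theorems
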